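import Summits.AnomalousDissipation.AnomalousDissipation.Theorems.BaireTransferDenseLoudDesignerForcesStubBirkhoffMeans

/-!
# Stub 4b `stub_shadowBudgets` of the line `ergodic-budget-selection-closing`
# (crux `BaireTransfer.DenseLoudDesignerForces`, stmt-AnomalousDissipation-1143)

Sorry-free discharge of the registered stub `stub_shadowBudgets` of the lead's skeleton
(`Cruxes/DenseLoudDesignerForces/Lines/ergodic-budget-selection-closing.lean`) over the landed line vocabulary
`Theorems/BaireTransferDenseLoudDesignerForcesErgodicLine.lean` (namespace `…Theorems.DenseLoudDesignerForces.Ergodic`: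
`Hsp`, `enstrophyObs`, `energyAvg`, `dissipAvg`, `IsNSPhase`) and the orbit-integrability helpers of the sibling
`Theorems/BaireTransferDenseLoudDesignerForcesStubBirkhoffMeans.lean`.

**Statement.**  For an NS phase `(K, φ)` (compact forward-invariant `K ⊂ H`, jointly continuous semiflow,
enstrophy continuous on `K`) and `δ > 0` there is `η > 0` such that, UNIFORMLY in `n ≥ 1`: whenever `z ∈ K`
`η`-shadows `x ∈ K` at the integer times `0 ≤ k ≤ n` and `|T - n| ≤ η`, the time means of the energy and of the
dissipation satisfy `|energyAvg φ z T - energyAvg φ x n| ≤ δ` and `|dissipAvg ν φ z T - dissipAvg ν φ x n| ≤ δ`.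
This is the deterministic real-analysis step converting the output of Katok's closing lemma (a periodic point
`z` of period `T ≈ n` shadowing a recurrent point `x`) into closeness of the trajectory budgets; no measure theory
and no PDE is used.

**Proof.**  For an observable `obs` continuous on `K` (applied to `‖·‖²` and to `ν · enstrophyObs`):
(i) `obs` is bounded by some `M ≥ 0` on the compact `K`; (ii) `(s, y) ↦ obs (φ_s y)` is continuous on the
compact `[0, 1] × K`, hence uniformly continuous (Heine–Cantor), giving `η₀` with
`|obs (φ_s y) - obs (φ_s y')| ≤ δ/4` for `dist y y' ≤ η₀`; (iii) by the semigroup law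
`φ_t = φ_{t-⌊t⌋} ∘ φ_{⌊t⌋}` the integer-time shadowing propagates to `|obs (φ_t z) - obs (φ_t x)| ≤ δ/4` for all
real `t ∈ [0, n]`, so `|∫₀ⁿ obs (φ_t z) - ∫₀ⁿ obs (φ_t x)| ≤ n δ/4`; (iv) the end piece `∫ₙᵀ obs (φ_t z)` is at
most `M η` and `|∫₀ⁿ obs (φ_t x)| ≤ M n`; (v) the bookkeeping `|T⁻¹A - n⁻¹B| ≤ δ` for
`η ≤ min (η₀, 1/2, δ/(8M+8))`, uniformly in `n ≥ 1`.

References: standard real analysis (Heine–Cantor); the line card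
`Cruxes/DenseLoudDesignerForces/Lines/ergodic-budget-selection-closing.md`; Barreira–Pesin, *Introduction to
Smooth Ergodic Theory* (2023) Thm 11.10 (the closing lemma whose output this stub consumes).
-/

set_option linter.dupNamespace false

noncomputable section

open scoped BigOperators Topology ENNReal InnerProductSpace
open Filter Set Function MeasureTheory

namespace Summit.AnomalousDissipation.AnomalousDissipation.Theorems.DenseLoudDesignerForces.Ergodic

open Literature.Analysis.FunctionSpaces Literature.Analysis.FunctionSpaces.Torus
open Literature.Analysis.FluidPDE Literature.Analysis.FluidPDE.Torus
open Summit.AnomalousDissipation.AnomalousDissipation.Theses.BaireTransfer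
open Summit.AnomalousDissipation.AnomalousDissipation.Theorems.DenseLoudDesignerForces.Negative

/-! ## Shadow budgets: shadowing orbits have close time means (stub 4b of the line) -/

section ShadowBudgets

variable {ν : ℝ} {F : (UnitAddTorus (Fin 3)) → (EuclideanSpace ℝ (Fin 3))} {K : Set Hsp} {φ : ℝ → Hsp → Hsp}

/-- An observable continuous on the compact `K` is bounded there by a nonnegative constant. [folklore] -/
theorem stub_shadowBudgets_aux_bound (hK : IsNSPhase ν F K φ) {obs : Hsp → ℝ}
    (hobs : ContinuousOn obs K) : ∃ M : ℝ, 0 ≤ M ∧ ∀ y ∈ K, ‖obs y‖ ≤ M := by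
  obtain ⟨C, hC⟩ := hK.isCompact.exists_bound_of_continuousOn hobs
  exact ⟨max C 0, le_max_right _ _, fun y hy => (hC y hy).trans (le_max_left _ _)⟩

/-- Uniform continuity of `(s, y) ↦ obs (φ_s y)` on the compact `[0, 1] × K` in the space variable: for every
`ε > 0` there is `η₀ > 0` with `|obs (φ_s y) - obs (φ_s y')| ≤ ε` whenever `s ∈ [0, 1]`, `y, y' ∈ K` and
`dist y y' ≤ η₀` (Heine–Cantor for the jointly continuous semiflow composed with `obs`). [folklore] -/
theorem stub_shadowBudgets_aux_uniform (hK : IsNSPhase ν F K φ) {obs : Hsp → ℝ}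
    (hobs : ContinuousOn obs K) {ε : ℝ} (hε : 0 < ε) :
    ∃ η₀ : ℝ, 0 < η₀ ∧ ∀ s ∈ Icc (0 : ℝ) 1, ∀ y ∈ K, ∀ y' ∈ K, dist y y' ≤ η₀ →
      |obs (φ s y) - obs (φ s y')| ≤ ε := by
  have hcpt : IsCompact (Icc (0 : ℝ) 1 ×ˢ K) := isCompact_Icc.prod hK.isCompact
  have hcont : ContinuousOn (fun q : ℝ × Hsp => obs (φ q.1 q.2)) (Icc (0 : ℝ) 1 ×ˢ K) := by
    have h1 : ContinuousOn (fun q : ℝ × Hsp => φ q.1 q.2) (Icc (0 : ℝ) 1 ×ˢ K) :=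
      hK.continuousOn.mono (prod_mono (fun s hs => hs.1) Subset.rfl)
    exact hobs.comp h1 fun q hq => hK.mapsTo q.1 hq.1.1 hq.2
  obtain ⟨η₀, hη₀, h⟩ :=
    Metric.uniformContinuousOn_iff_le.1 (hcpt.uniformContinuousOn_of_continuous hcont) ε hε
  refine ⟨η₀, hη₀, fun s hs y hy y' hy' hd => ?_⟩
  have h2 := h (s, y) ⟨hs, hy⟩ (s, y') ⟨hs, hy'⟩ (by rwa [dist_prod_same_left])
  rwa [Real.dist_eq] at h2

/-- Shadowing at the integer times `0 ≤ k ≤ n` propagates to every real time `t ∈ [0, n]` through the semigroup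
law `φ_t = φ_{t-⌊t⌋} ∘ φ_{⌊t⌋}` on `K` and a uniform continuity modulus of `(s, y) ↦ obs (φ_s y)` on
`[0, 1] × K`. [folklore] -/
theorem stub_shadowBudgets_aux_pointwise (hK : IsNSPhase ν F K φ) {obs : Hsp → ℝ} {ε η₀ : ℝ}
    (hmod : ∀ s ∈ Icc (0 : ℝ) 1, ∀ y ∈ K, ∀ y' ∈ K, dist y y' ≤ η₀ → |obs (φ s y) - obs (φ s y')| ≤ ε)
    {x z : Hsp} (hx : x ∈ K) (hz : z ∈ K) {n : ℕ} (hsh : ∀ k : ℕ, k ≤ n → dist (φ k z) (φ k x) ≤ η₀)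
    {t : ℝ} (ht0 : 0 ≤ t) (htn : t ≤ n) : |obs (φ t z) - obs (φ t x)| ≤ ε := by
  have hkt : ((⌊t⌋₊ : ℕ) : ℝ) ≤ t := Nat.floor_le ht0
  have htk : t < (⌊t⌋₊ : ℕ) + 1 := Nat.lt_floor_add_one t
  have hkn : ⌊t⌋₊ ≤ n := Nat.floor_le_of_le htn
  have hs : t - (⌊t⌋₊ : ℕ) ∈ Icc (0 : ℝ) 1 := ⟨by linarith, by linarith⟩
  have hzt : φ t z = φ (t - (⌊t⌋₊ : ℕ)) (φ (⌊t⌋₊ : ℕ) z) := by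
    rw [← hK.map_add (t - (⌊t⌋₊ : ℕ)) (⌊t⌋₊ : ℕ) hs.1 (Nat.cast_nonneg _) z hz, sub_add_cancel]
  have hxt : φ t x = φ (t - (⌊t⌋₊ : ℕ)) (φ (⌊t⌋₊ : ℕ) x) := by
    rw [← hK.map_add (t - (⌊t⌋₊ : ℕ)) (⌊t⌋₊ : ℕ) hs.1 (Nat.cast_nonneg _) x hx, sub_add_cancel]
  rw [hzt, hxt]
  exact hmod _ hs _ (hK.mapsTo _ (Nat.cast_nonneg _) hz) _ (hK.mapsTo _ (Nat.cast_nonneg _) hx)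
    (hsh _ hkn)

/-- The bookkeeping inequality behind the shadow budgets: if `|A - A'| ≤ M η` (end piece), `|A' - B| ≤ n δ/4`
(bulk), `|B| ≤ M n`, `|T - n| ≤ η ≤ 1/2`, `η (8M + 8) ≤ δ` and `n ≥ 1`, then `|T⁻¹ A - n⁻¹ B| ≤ δ`.
[folklore] -/
theorem stub_shadowBudgets_aux_arith {A A' B M η δ T n : ℝ} (hδ : 0 < δ) (hη : 0 ≤ η)
    (hη₂ : η ≤ 1 / 2) (hη₃ : η * (8 * M + 8) ≤ δ) (hn : 1 ≤ n) (hT : |T - n| ≤ η)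
    (h1 : |A - A'| ≤ M * η) (h2 : |A' - B| ≤ δ / 4 * n) (h3 : |B| ≤ M * n) :
    |T⁻¹ * A - n⁻¹ * B| ≤ δ := by
  have hn0 : (0 : ℝ) < n := by linarith
  have hTl : n - η ≤ T := by linarith [(abs_le.1 hT).1]
  have hTpos : 0 < T := by linarith
  have hTn : |n - T| ≤ η := by rwa [abs_sub_comm]
  have e1 : T⁻¹ * A - n⁻¹ * B = (n * A - T * B) / (T * n) := by
    rw [eq_div_iff (mul_pos hTpos hn0).ne']
    calc (T⁻¹ * A - n⁻¹ * B) * (T * n) = T⁻¹ * T * A * n - n⁻¹ * n * B * T := by ring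
      _ = n * A - T * B := by rw [inv_mul_cancel₀ hTpos.ne', inv_mul_cancel₀ hn0.ne']; ring
  rw [e1, abs_div, abs_of_pos (mul_pos hTpos hn0), div_le_iff₀ (mul_pos hTpos hn0)]
  have e2 : n * A - T * B = n * (A - A') + n * (A' - B) + (n - T) * B := by ring
  rw [e2]
  have i1 := mul_le_mul_of_nonneg_left h1 hn0.le
  have i2 := mul_le_mul_of_nonneg_left h2 hn0.le
  have i3 : |n - T| * |B| ≤ η * (M * n) := mul_le_mul hTn h3 (abs_nonneg _) hη
  have h9 : δ * (n - η) ≤ δ * T := mul_le_mul_of_nonneg_left hTl hδ.le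
  have h10 : δ * 1 ≤ δ * n := mul_le_mul_of_nonneg_left hn hδ.le
  have h11 : δ * η ≤ δ * (1 / 2) := mul_le_mul_of_nonneg_left hη₂ hδ.le
  have key : 2 * M * η + δ / 4 * n ≤ δ * T := by linarith
  calc |n * (A - A') + n * (A' - B) + (n - T) * B|
      ≤ |n * (A - A')| + |n * (A' - B)| + |(n - T) * B| := abs_add_three _ _ _
    _ = n * |A - A'| + n * |A' - B| + |n - T| * |B| := by
        rw [abs_mul, abs_mul, abs_mul, abs_of_pos hn0]
    _ ≤ n * (M * η) + n * (δ / 4 * n) + η * (M * n) := by linarith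
    _ = n * (2 * M * η + δ / 4 * n) := by ring
    _ ≤ n * (δ * T) := mul_le_mul_of_nonneg_left key hn0.le
    _ = δ * (T * n) := by ring

/-- **Shadow budgets for one observable.**  For `obs` continuous on `K` and `δ > 0` there is `η > 0` such that,
uniformly in `n ≥ 1`: if `z ∈ K` `η`-shadows `x ∈ K` at the integer times `0 ≤ k ≤ n` and `|T - n| ≤ η`, then
the time means `T⁻¹ ∫₀ᵀ obs (φ_t z) dt` and `n⁻¹ ∫₀ⁿ obs (φ_t x) dt` differ by at most `δ` (uniform continuity on
`[0, 1] × K` + semigroup law for the bulk `[0, n]`, boundedness of `obs` on `K` for the end piece `[n, T]`).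
[folklore] -/
theorem stub_shadowBudgets_aux_observable (hK : IsNSPhase ν F K φ) {obs : Hsp → ℝ}
    (hobs : ContinuousOn obs K) {δ : ℝ} (hδ : 0 < δ) :
    ∃ η : ℝ, 0 < η ∧ ∀ x ∈ K, ∀ z ∈ K, ∀ n : ℕ, 0 < n → ∀ T : ℝ, |T - n| ≤ η →
      (∀ k : ℕ, k ≤ n → dist (φ k z) (φ k x) ≤ η) →
      |T⁻¹ * (∫ t in (0 : ℝ)..T, obs (φ t z)) - (n : ℝ)⁻¹ * ∫ t in (0 : ℝ)..n, obs (φ t x)| ≤ δ := by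
  obtain ⟨M, hM0, hM⟩ := stub_shadowBudgets_aux_bound hK hobs
  obtain ⟨η₀, hη₀, hmod⟩ := stub_shadowBudgets_aux_uniform hK hobs (by positivity : 0 < δ / 4)
  have hMpos : 0 < 8 * M + 8 := by positivity
  obtain ⟨η, hη, hη₁, hη₂, hη₃⟩ : ∃ η : ℝ, 0 < η ∧ η ≤ η₀ ∧ η ≤ 1 / 2 ∧ η ≤ δ / (8 * M + 8) :=
    ⟨min η₀ (min (1 / 2) (δ / (8 * M + 8))), lt_min hη₀ (lt_min one_half_pos (div_pos hδ hMpos)),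
      min_le_left _ _, (min_le_right _ _).trans (min_le_left _ _),
      (min_le_right _ _).trans (min_le_right _ _)⟩
  refine ⟨η, hη, fun x hx z hz n hn T hT hsh => ?_⟩
  have hn1 : (1 : ℝ) ≤ n := Nat.one_le_cast.2 hn
  have hn0 : (0 : ℝ) < n := by linarith
  have hTl : (n : ℝ) - η ≤ T := by linarith [(abs_le.1 hT).1]
  have hTpos : 0 < T := by linarith
  -- end piece `[n, T]`
  have h1 : |(∫ t in (0 : ℝ)..T, obs (φ t z)) - ∫ t in (0 : ℝ)..n, obs (φ t z)| ≤ M * η := by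
    rw [intervalIntegral.integral_interval_sub_left
      (stub_birkhoffMeans_aux_intervalIntegrable hK hobs hz le_rfl hTpos.le)
      (stub_birkhoffMeans_aux_intervalIntegrable hK hobs hz le_rfl hn0.le)]
    have hb : ∀ t ∈ uIoc (n : ℝ) T, ‖obs (φ t z)‖ ≤ M := by
      intro t ht
      have hmin : (n : ℝ) - η ≤ min (n : ℝ) T := le_min (by linarith) hTl
      have ht0 : 0 ≤ t := by linarith [ht.1]
      exact hM _ (hK.mapsTo t ht0 hz)
    calc |∫ t in (n : ℝ)..T, obs (φ t z)| = ‖∫ t in (n : ℝ)..T, obs (φ t z)‖ := (Real.norm_eq_abs _).symm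
      _ ≤ M * |T - n| := intervalIntegral.norm_integral_le_of_norm_le_const hb
      _ ≤ M * η := mul_le_mul_of_nonneg_left hT hM0
  -- bulk `[0, n]`
  have h2 : |(∫ t in (0 : ℝ)..n, obs (φ t z)) - ∫ t in (0 : ℝ)..n, obs (φ t x)| ≤ δ / 4 * n := by
    rw [← intervalIntegral.integral_sub
      (stub_birkhoffMeans_aux_intervalIntegrable hK hobs hz le_rfl hn0.le)
      (stub_birkhoffMeans_aux_intervalIntegrable hK hobs hx le_rfl hn0.le)]
    have hb : ∀ t ∈ uIoc (0 : ℝ) n, ‖obs (φ t z) - obs (φ t x)‖ ≤ δ / 4 := by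
      intro t ht
      rw [uIoc_of_le hn0.le] at ht
      rw [Real.norm_eq_abs]
      exact stub_shadowBudgets_aux_pointwise hK hmod hx hz (fun k hk => (hsh k hk).trans hη₁)
        ht.1.le ht.2
    calc |∫ t in (0 : ℝ)..n, (obs (φ t z) - obs (φ t x))|
        = ‖∫ t in (0 : ℝ)..n, (obs (φ t z) - obs (φ t x))‖ := (Real.norm_eq_abs _).symm
      _ ≤ δ / 4 * |(n : ℝ) - 0| := intervalIntegral.norm_integral_le_of_norm_le_const hb
      _ = δ / 4 * n := by rw [sub_zero, abs_of_pos hn0]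
  -- size of the reference integral
  have h3 : |∫ t in (0 : ℝ)..n, obs (φ t x)| ≤ M * n := by
    have hb : ∀ t ∈ uIoc (0 : ℝ) n, ‖obs (φ t x)‖ ≤ M := by
      intro t ht
      rw [uIoc_of_le hn0.le] at ht
      exact hM _ (hK.mapsTo t ht.1.le hx)
    calc |∫ t in (0 : ℝ)..n, obs (φ t x)| = ‖∫ t in (0 : ℝ)..n, obs (φ t x)‖ := (Real.norm_eq_abs _).symm
      _ ≤ M * |(n : ℝ) - 0| := intervalIntegral.norm_integral_le_of_norm_le_const hb
      _ = M * n := by rw [sub_zero, abs_of_pos hn0]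
  exact stub_shadowBudgets_aux_arith hδ hη.le hη₂ ((le_div_iff₀ hMpos).1 hη₃) hn1 hT h1 h2 h3

/-- **Stub 4b of the line `ergodic-budget-selection-closing`: shadow budgets.**  For an NS phase `(K, φ)` and
`δ > 0` there is `η > 0` such that, uniformly in `n ≥ 1`: if `z ∈ K` `η`-shadows `x ∈ K` at the integer times
`0 ≤ k ≤ n` (`dist (φ_k z) (φ_k x) ≤ η`) and `|T - n| ≤ η`, then the time-mean energies and the time-mean
dissipations satisfy `|energyAvg φ z T - energyAvg φ x n| ≤ δ` and `|dissipAvg ν φ z T - dissipAvg ν φ x n| ≤ δ`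
(deterministic: uniform continuity of `(s, y) ↦ ‖φ_s y‖², ν‖∇φ_s y‖²` on the compact `[0, 1] × K`, the semigroup
law, and boundedness of the observables on `K`; this converts the output of Katok's closing lemma into closeness
of the trajectory budgets). [folklore] -/
theorem stub_shadowBudgets {ν : ℝ} {F : (UnitAddTorus (Fin 3)) → (EuclideanSpace ℝ (Fin 3))} {K : Set Hsp} {φ : ℝ → Hsp → Hsp} (hK : IsNSPhase ν F K φ) {δ : ℝ} (hδ : 0 < δ) : ∃ η : ℝ, 0 < η ∧ ∀ x ∈ K, ∀ z ∈ K, ∀ n : ℕ, 0 < n → ∀ T : ℝ, |T - n| ≤ η → (∀ k : ℕ, k ≤ n → dist (φ k z) (φ k x) ≤ η) → |energyAvg φ z T - energyAvg φ x n| ≤ δ ∧ |dissipAvg ν φ z T - dissipAvg ν φ x n| ≤ δ := by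
  have hobs₁ : ContinuousOn (fun y : Hsp => ‖y‖ ^ 2) K := (continuous_norm.pow 2).continuousOn
  have hobs₂ : ContinuousOn (fun y : Hsp => ν * enstrophyObs y) K :=
    continuousOn_const.mul hK.enstrophy_continuousOn
  obtain ⟨η₁, hη₁, h₁⟩ := stub_shadowBudgets_aux_observable hK hobs₁ hδ
  obtain ⟨η₂, hη₂, h₂⟩ := stub_shadowBudgets_aux_observable hK hobs₂ hδ
  refine ⟨min η₁ η₂, lt_min hη₁ hη₂, fun x hx z hz n hn T hT hsh => ⟨?_, ?_⟩⟩
  · exact h₁ x hx z hz n hn T (hT.trans (min_le_left _ _)) fun k hk => (hsh k hk).trans (min_le_left _ _)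
  · exact h₂ x hx z hz n hn T (hT.trans (min_le_right _ _)) fun k hk => (hsh k hk).trans (min_le_right _ _)

end ShadowBudgets

end Summit.AnomalousDissipation.AnomalousDissipation.Theorems.DenseLoudDesignerForces.Ergodic

end
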